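import Literature.NumberTheory.LFunctions.ChebotarevNaturalDensityCyclic
import Literature.NumberTheory.LFunctions.ChebotarevNaturalDensity
import Literature.NumberTheory.LFunctions.ChebotarevCrossingPushDown
import Literature.NumberTheory.LFunctions.PrimeIdealCountRatioProofs
import Literature.NumberTheory.LFunctions.PrimeIdealCountDegreeOne
import Mathlib.NumberTheory.PrimeCounting
import HarnessLib

/-!
# Chebotarev's density theorem in natural-density form (Serre 1981, §2.1, Thm. 1): the proof

Topic `Literature/NumberTheory/LFunctions`; namespace `Literature.NumberTheory.LFunctions.Chebotarev`.
Pure-proof sibling of `ChebotarevNaturalDensity.lean`, whose named fact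
`chebotarev_naturalDensity` (for every finite Galois extension `L|K` of number fields and every
conjugation-stable `C ⊆ G(L|K)`, `π_C(x)/π_K(x) → |C|/|G|`) is DISCHARGED here:
`chebotarev_naturalDensity_holds`.  Theorems only (no definition, no named fact).

## Proof (Neukirch VII (13.4), natural-density version; Deuring's reduction)

1. **Cyclic case** (`ChebotarevNaturalDensityCyclic.lean`): for `L/E` cyclic and `σ ∈ Gal(L/E)`, the primes
   of `E` with Frobenius `σ` have natural density `1/[L:E]` (Artin reciprocity + Hecke–Landau +
   Wiener–Ikehara).
2. **Deuring's reduction, counted** (`card_mul_primeNormCount_frobenius_eq`,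
   `eventually_primeNormCount_frobenius_eq_mul`, this file): for `h ∈ G = Gal(L/K)`,
   an intermediate field `E` with `H = Gal(L/E)` abelian containing `h`, and a rational prime `p` outside a
   finite set, the primes `𝔔` of `E` of norm `p` with `Frob_{L/E}(𝔔) = h` number `#C_G(h)/#H` times the
   primes `𝔭 ∈ P_{L|K}(h)` of `K` of norm `p` (the tree's relative Deuring count
   `GaloisRepresentations.DegreeOnePrimesRel.card_mul_card_frob_eq_card_conj_eq`, summed over the primes
   `𝔭` of `K` of norm `p`; Neukirch: "`ρ⁻¹(𝔭) ≅ Z(σ)/(σ)`").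
3. **Only degree-one primes count** (`tendsto_of_primeNormCount_eq_mul`): primes of non-prime norm `≤ N`
   are `O(√N)` (`NumberField.sum_normPrimeIdealCount_not_prime_le`), finitely many exceptional `p`
   contribute `O(1)`, so natural densities transfer through the relation of step 2; with `E = L^{⟨h⟩}`:
   `d(P_{L|K}(h)) = (#H/#C_G(h)) · (1/#H) = #⟨h⟩/#G` (`card_setOf_isConj_mul_card_centralizer`).
4. **Conjugation-stable `C`**: `1_{P(C)} = Σ_{σ ∈ C} (#⟨σ⟩)⁻¹ 1_{P(σ)}` (`indicator_primesOfFrobIn_eq_sum`),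
   so the densities add up to `#C/#G`; finally `π_K(N) log N/N → 1` (Landau's prime ideal theorem,
   `NumberField.isEquivalent_primeIdealCount`) turns `π_C(N) log N/N → #C/#G` into
   `π_C(x)/π_K(x) → #C/#G`, the counting functions depending on `⌊x⌋` only.

## References

* J.-P. Serre, *Quelques applications du théorème de densité de Chebotarev*, Publ. Math. IHÉS 54 (1981),
  §2.1, Thm. 1 with (8)–(9), p. 331. [Serre1981]
* J. Neukirch, *Algebraic Number Theory*, Springer 1999, VII (13.4) and its proof, p. 545. [NeukirchANT1999]
* M. Deuring, *Über den Tschebotareffschen Dichtigkeitssatz*, Math. Ann. 110 (1935), 414–415. [folklore]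
-/

noncomputable section

open Filter NumberField IsDedekindDomain Ideal Finset Asymptotics

open scoped _root_.Topology Classical Pointwise

namespace Literature.NumberTheory.LFunctions.Chebotarev

/-! ### Counting primes by norm: non-prime norms and finitely many primes are negligible -/

section Counting

variable {K : Type*} [Field K] [NumberField K]

/-- `#{𝔭 ∈ X : N𝔭 = n} ≤ G(n)`, Landau's count of ALL prime ideals of norm `n`. [folklore] -/
theorem primeNormCount_le_normPrimeIdealCount (X : Set (HeightOneSpectrum (𝓞 K))) (n : ℕ) :
    primeNormCount K X n ≤ NumberField.normPrimeIdealCount K n := by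
  rw [primeNormCount, NumberField.normPrimeIdealCount,
    Set.ncard_eq_toFinset_card _ (NumberField.finite_setOf_prime_absNorm_eq K n)]
  refine (Finset.card_filter_le _ _).trans ?_
  refine Finset.card_le_card_of_injOn (fun v => v.asIdeal) (fun v hv => ?_) (fun v _ w _ h => ?_)
  · rw [Finset.mem_coe, mem_primesOfNorm] at hv
    rw [Finset.mem_coe, Set.Finite.mem_toFinset]
    exact ⟨v.isPrime, v.ne_bot, hv⟩
  · exact HeightOneSpectrum.ext h

/-- At a prime `p` there are at most `[K:ℚ]` primes of norm `p`. [folklore] -/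
theorem primeNormCount_prime_le_finrank (X : Set (HeightOneSpectrum (𝓞 K))) {p : ℕ} (hp : p.Prime) :
    primeNormCount K X p ≤ Module.finrank ℚ K :=
  (primeNormCount_le_idealNormCount X p).trans (NumberField.idealNormCount_prime_le_finrank K hp)

/-- **Primes of non-prime norm are `O(√N)`**: `Σ_{n ≤ N, n not prime} #{𝔭 ∈ X : N𝔭 = n} ≤ [K:ℚ](√N + 1)`
(such a prime lies over a rational prime `q ≤ √N`, at most `[K:ℚ]` over each; tree
`NumberField.sum_normPrimeIdealCount_not_prime_le`). [folklore] -/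
theorem sum_filter_not_prime_primeNormCount_le (X : Set (HeightOneSpectrum (𝓞 K))) (N : ℕ) :
    ∑ n ∈ (Icc 1 N).filter (fun n => ¬ n.Prime), (primeNormCount K X n : ℝ) ≤
      Module.finrank ℚ K * ((Nat.sqrt N : ℝ) + 1) := by
  have h1 : ∑ n ∈ (Icc 1 N).filter (fun n => ¬ n.Prime), primeNormCount K X n ≤
      ∑ n ∈ (Icc 0 N).filter (fun n => ¬ n.Prime), NumberField.normPrimeIdealCount K n := by
    refine (Finset.sum_le_sum fun n _ => primeNormCount_le_normPrimeIdealCount X n).trans ?_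
    refine Finset.sum_le_sum_of_subset_of_nonneg (fun n hn => ?_) (fun _ _ _ => Nat.zero_le _)
    simp only [Finset.mem_filter, Finset.mem_Icc] at hn ⊢
    exact ⟨⟨Nat.zero_le _, hn.1.2⟩, hn.2⟩
  have h2 := NumberField.sum_normPrimeIdealCount_not_prime_le (K := K) N
  have h3 : Nat.primeCounting (Nat.sqrt N) ≤ Nat.sqrt N + 1 := by
    rw [Nat.primeCounting_eq_primeCounting'_succ]
    exact Nat.count_le _
  have h4 : (∑ n ∈ (Icc 1 N).filter (fun n => ¬ n.Prime), primeNormCount K X n : ℝ) ≤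
      (Module.finrank ℚ K * (Nat.sqrt N + 1) : ℕ) := by
    exact_mod_cast (h1.trans h2).trans (Nat.mul_le_mul_left _ h3)
  push_cast at h4 ⊢
  exact h4

/-- A sum of `#{𝔭 ∈ X : N𝔭 = p}` over a finite set `B` of rational primes is `≤ [K:ℚ] #B`. [folklore] -/
theorem sum_primeNormCount_le_of_prime (X : Set (HeightOneSpectrum (𝓞 K))) {B : Finset ℕ}
    (hB : ∀ n ∈ B, n.Prime) :
    ∑ n ∈ B, (primeNormCount K X n : ℝ) ≤ (Module.finrank ℚ K : ℝ) * B.card := by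
  calc ∑ n ∈ B, (primeNormCount K X n : ℝ) ≤ ∑ n ∈ B, (Module.finrank ℚ K : ℝ) :=
        Finset.sum_le_sum fun n hn => by exact_mod_cast primeNormCount_prime_le_finrank X (hB n hn)
    _ = (Module.finrank ℚ K : ℝ) * B.card := by rw [Finset.sum_const, nsmul_eq_mul, mul_comm]

/-- `(√N + 1) · log N / N → 0`. [folklore] -/
theorem tendsto_sqrt_add_one_mul_log_div :
    Tendsto (fun N : ℕ => ((Nat.sqrt N : ℝ) + 1) * Real.log N / N) atTop (𝓝 0) := by
  -- compare with `2 √N log N / N = 2 log N / √N → 0`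
  have h1 : Tendsto (fun x : ℝ => Real.log x / x ^ (1 / 2 : ℝ)) atTop (𝓝 0) := by
    have := (isLittleO_log_rpow_atTop (by norm_num : (0 : ℝ) < 1 / 2)).tendsto_div_nhds_zero
    simpa using this
  have h2 : Tendsto (fun N : ℕ => 2 * (Real.log N / (N : ℝ) ^ (1 / 2 : ℝ))) atTop (𝓝 0) := by
    simpa using (h1.comp tendsto_natCast_atTop_atTop).const_mul 2
  refine squeeze_zero' ?_ ?_ h2
  · filter_upwards [eventually_ge_atTop 1] with N hN
    exact div_nonneg (mul_nonneg (by positivity) (Real.log_nonneg (by exact_mod_cast hN))) (Nat.cast_nonneg _)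
  · filter_upwards [eventually_ge_atTop 1] with N hN
    have hN0 : (0 : ℝ) < N := by exact_mod_cast hN
    set s : ℝ := (N : ℝ) ^ (1 / 2 : ℝ) with hsdef
    have hpos : 0 < s := Real.rpow_pos_of_pos hN0 _
    have hhalf : s * s = N := by
      rw [hsdef, ← Real.rpow_add hN0]; norm_num
    have hsqrt : ((Nat.sqrt N : ℝ) + 1) ≤ 2 * s := by
      have hs : (Nat.sqrt N : ℝ) ≤ s := by
        rw [hsdef, ← Real.sqrt_eq_rpow, Real.le_sqrt (Nat.cast_nonneg _) hN0.le]
        exact_mod_cast Nat.sqrt_le' N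
      have h1' : (1 : ℝ) ≤ s := by rw [hsdef]; exact Real.one_le_rpow (by exact_mod_cast hN) (by norm_num)
      linarith
    have hlog : 0 ≤ Real.log N := Real.log_nonneg (by exact_mod_cast hN)
    set l : ℝ := Real.log N with hldef
    calc ((Nat.sqrt N : ℝ) + 1) * l / N ≤ 2 * s * l / N := by
          gcongr
      _ = 2 * (l / s) := by
          rw [← hhalf]
          field_simp

/-- **The negligible part of a norm count.**  For a finite set `B` of rational primes, the primes `𝔭 ∈ X`
with `N𝔭 ≤ N` whose norm is NOT a prime outside `B` number `o(N/log N)`: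
`(Σ_{n ≤ N, ¬(n prime ∧ n ∉ B)} #{𝔭 ∈ X : N𝔭 = n}) · log N / N → 0`. [folklore] -/
theorem tendsto_sum_filter_bad_mul_log_div (X : Set (HeightOneSpectrum (𝓞 K))) {B : Finset ℕ}
    (hB : ∀ n ∈ B, n.Prime) :
    Tendsto (fun N : ℕ => (∑ n ∈ (Icc 1 N).filter (fun n => ¬ (n.Prime ∧ n ∉ B)),
      (primeNormCount K X n : ℝ)) * Real.log N / N) atTop (𝓝 0) := by
  set d : ℝ := (Module.finrank ℚ K : ℝ) with hd
  have hbound : ∀ N : ℕ, ∑ n ∈ (Icc 1 N).filter (fun n => ¬ (n.Prime ∧ n ∉ B)), (primeNormCount K X n : ℝ) ≤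
      d * (1 + B.card) * ((Nat.sqrt N : ℝ) + 1) := by
    intro N
    have hsub : (Icc 1 N).filter (fun n => ¬ (n.Prime ∧ n ∉ B)) ⊆ (Icc 1 N).filter (fun n => ¬ n.Prime) ∪ B := by
      intro n hn
      simp only [Finset.mem_filter, not_and, not_not] at hn
      simp only [Finset.mem_union, Finset.mem_filter]
      by_cases hpr : n.Prime
      · exact Or.inr (hn.2 hpr)
      · exact Or.inl ⟨hn.1, hpr⟩
    calc ∑ n ∈ (Icc 1 N).filter (fun n => ¬ (n.Prime ∧ n ∉ B)), (primeNormCount K X n : ℝ)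
        ≤ ∑ n ∈ (Icc 1 N).filter (fun n => ¬ n.Prime) ∪ B, (primeNormCount K X n : ℝ) :=
          Finset.sum_le_sum_of_subset_of_nonneg hsub fun _ _ _ => Nat.cast_nonneg _
      _ ≤ ∑ n ∈ (Icc 1 N).filter (fun n => ¬ n.Prime), (primeNormCount K X n : ℝ) +
          ∑ n ∈ B, (primeNormCount K X n : ℝ) := by
          rw [← Finset.sum_union_inter]
          have : 0 ≤ ∑ n ∈ (Icc 1 N).filter (fun n => ¬ n.Prime) ∩ B, (primeNormCount K X n : ℝ) :=
            Finset.sum_nonneg fun _ _ => Nat.cast_nonneg _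
          linarith
      _ ≤ d * ((Nat.sqrt N : ℝ) + 1) + d * B.card :=
          add_le_add (sum_filter_not_prime_primeNormCount_le X N) (sum_primeNormCount_le_of_prime X hB)
      _ ≤ d * (1 + B.card) * ((Nat.sqrt N : ℝ) + 1) := by
          have hd0 : 0 ≤ d := by rw [hd]; positivity
          have h1 : (B.card : ℝ) ≤ B.card * ((Nat.sqrt N : ℝ) + 1) :=
            le_mul_of_one_le_right (Nat.cast_nonneg _) (by linarith [(Nat.cast_nonneg (Nat.sqrt N) : (0:ℝ) ≤ _)])
          nlinarith
  have hlim : Tendsto (fun N : ℕ => d * (1 + B.card) * (((Nat.sqrt N : ℝ) + 1) * Real.log N / N)) atTop (𝓝 0) := by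
    simpa using tendsto_sqrt_add_one_mul_log_div.const_mul (d * (1 + B.card))
  refine squeeze_zero' ?_ ?_ hlim
  · filter_upwards [eventually_ge_atTop 1] with N hN
    exact div_nonneg (mul_nonneg (Finset.sum_nonneg fun _ _ => Nat.cast_nonneg _)
      (Real.log_nonneg (by exact_mod_cast hN))) (Nat.cast_nonneg _)
  · filter_upwards [eventually_ge_atTop 1] with N hN
    have hN0 : (0 : ℝ) < N := by exact_mod_cast hN
    have hlog : 0 ≤ Real.log N := Real.log_nonneg (by exact_mod_cast hN)
    rw [mul_div_assoc, mul_div_assoc, ← mul_assoc]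
    exact mul_le_mul_of_nonneg_right (hbound N) (div_nonneg hlog hN0.le)

/-- **Transfer of natural densities through a prime-by-prime count relation.**  Let `X` be a set of
primes of `F`, `Y` a set of primes of `K`, `a > 0`, and suppose `#{𝔔 ∈ X : N𝔔 = p} = a · #{𝔭 ∈ Y : N𝔭 = p}`
for all but finitely many rational primes `p`.  If `#{𝔔 ∈ X : N𝔔 ≤ N} log N/N → c` then
`#{𝔭 ∈ Y : N𝔭 ≤ N} log N/N → c/a` (non-prime norms and finitely many `p` are negligible,
`tendsto_sum_filter_bad_mul_log_div`).  Counting form of "only the prime ideals of degree one matter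
for densities" (Neukirch VII §13, p. 543). [cite: NeukirchANT1999, VII §13, p. 543 and (13.4) proof] -/
theorem tendsto_of_primeNormCount_eq_mul {F : Type*} [Field F] [NumberField F]
    (X : Set (HeightOneSpectrum (𝓞 F))) (Y : Set (HeightOneSpectrum (𝓞 K))) {a c : ℝ} (ha : 0 < a)
    (hrel : ∀ᶠ p : Nat.Primes in cofinite, (primeNormCount F X p : ℝ) = a * primeNormCount K Y p)
    (hX : Tendsto (fun N : ℕ => (∑ n ∈ Icc 1 N, (primeNormCount F X n : ℝ)) * Real.log N / N) atTop (𝓝 c)) :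
    Tendsto (fun N : ℕ => (∑ n ∈ Icc 1 N, (primeNormCount K Y n : ℝ)) * Real.log N / N) atTop (𝓝 (c / a)) := by
  -- the finite exceptional set, as a set of rational primes
  obtain ⟨B, hBprime, hB⟩ : ∃ B : Finset ℕ, (∀ n ∈ B, n.Prime) ∧ ∀ n : ℕ, n.Prime → n ∉ B →
      (primeNormCount F X n : ℝ) = a * primeNormCount K Y n := by
    have hfin : {p : Nat.Primes | ¬ ((primeNormCount F X p : ℝ) = a * primeNormCount K Y p)}.Finite :=
      Filter.eventually_cofinite.mp hrel
    refine ⟨(hfin.image (fun p : Nat.Primes => (p : ℕ))).toFinset, fun n hn => ?_, fun n hn hnB => ?_⟩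
    · rw [Set.Finite.mem_toFinset] at hn
      obtain ⟨p, -, rfl⟩ := hn
      exact p.2
    · by_contra h
      refine hnB ?_
      rw [Set.Finite.mem_toFinset]
      exact ⟨⟨n, hn⟩, h, rfl⟩
  -- good / bad splitting
  have hsplit : ∀ (g : ℕ → ℝ) (N : ℕ), ∑ n ∈ Icc 1 N, g n =
      ∑ n ∈ (Icc 1 N).filter (fun n => n.Prime ∧ n ∉ B), g n +
        ∑ n ∈ (Icc 1 N).filter (fun n => ¬ (n.Prime ∧ n ∉ B)), g n :=
    fun g N => (Finset.sum_filter_add_sum_filter_not _ _ _).symm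
  have hgood : ∀ N : ℕ, ∑ n ∈ (Icc 1 N).filter (fun n => n.Prime ∧ n ∉ B), (primeNormCount F X n : ℝ) =
      a * ∑ n ∈ (Icc 1 N).filter (fun n => n.Prime ∧ n ∉ B), (primeNormCount K Y n : ℝ) := by
    intro N
    rw [Finset.mul_sum]
    refine Finset.sum_congr rfl fun n hn => ?_
    rw [Finset.mem_filter] at hn
    exact hB n hn.2.1 hn.2.2
  have hbadF := tendsto_sum_filter_bad_mul_log_div X hBprime
  have hbadK := tendsto_sum_filter_bad_mul_log_div Y hBprime
  have key : ∀ N : ℕ, (∑ n ∈ Icc 1 N, (primeNormCount K Y n : ℝ)) * Real.log N / N =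
      a⁻¹ * ((∑ n ∈ Icc 1 N, (primeNormCount F X n : ℝ)) * Real.log N / N) -
        a⁻¹ * ((∑ n ∈ (Icc 1 N).filter (fun n => ¬ (n.Prime ∧ n ∉ B)), (primeNormCount F X n : ℝ)) *
          Real.log N / N) +
        (∑ n ∈ (Icc 1 N).filter (fun n => ¬ (n.Prime ∧ n ∉ B)), (primeNormCount K Y n : ℝ)) *
          Real.log N / N := by
    intro N
    rw [hsplit (fun n => (primeNormCount K Y n : ℝ)) N, hsplit (fun n => (primeNormCount F X n : ℝ)) N,
      hgood N]
    field_simp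
    ring
  have hlim := ((hX.const_mul a⁻¹).sub (hbadF.const_mul a⁻¹)).add hbadK
  rw [mul_zero, sub_zero, add_zero, ← div_eq_inv_mul] at hlim
  exact hlim.congr fun N => (key N).symm

end Counting

/-! ### Deuring's reduction, counted over a general base -/

section Deuring

variable {K L : Type} [Field K] [NumberField K] [Field L] [NumberField L] [Algebra K L] [IsGalois K L]
  (E : IntermediateField K L)

omit [NumberField L] [IsGalois K L] in
/-- A prime `𝔔` of `E` of prime norm `p` lies over a prime `𝔭` of `K` of norm `p` with residue degree
`f(𝔔|𝔭) = 1` (`N𝔔 = N𝔭^{f}`). [folklore] -/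
theorem absNorm_under_eq_and_inertiaDeg_eq_one [NumberField E] (𝔔 : HeightOneSpectrum (𝓞 E))
    {p : ℕ} (hp : p.Prime) (hN : absNorm 𝔔.asIdeal = p) :
    absNorm (𝔔.under (𝓞 K)).asIdeal = p ∧ 𝔔.asIdeal.inertiaDeg (𝓞 K) = 1 := by
  have hpow := GaloisRepresentations.absNorm_under_pow_inertiaDeg (M := K) 𝔔
  rw [hN] at hpow
  have h := (Nat.Prime.pow_eq_iff hp).mp hpow
  exact ⟨h.1, h.2⟩

omit [NumberField L] [IsGalois K L] in
/-- Conversely, a prime of `E` over `𝔭` with `N𝔭 = p` and `f = 1` has norm `p`. [folklore] -/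
theorem absNorm_eq_of_under_eq_of_inertiaDeg_eq_one [NumberField E] (𝔔 : HeightOneSpectrum (𝓞 E))
    {p : ℕ} (hN : absNorm (𝔔.under (𝓞 K)).asIdeal = p) (hf : 𝔔.asIdeal.inertiaDeg (𝓞 K) = 1) :
    absNorm 𝔔.asIdeal = p := by
  have hpow := GaloisRepresentations.absNorm_under_pow_inertiaDeg (M := K) 𝔔
  rw [hN, hf, pow_one] at hpow
  exact hpow.symm

omit [NumberField L] [IsGalois K L] in
/-- **Counting reformulation over a general base.**  The primes `𝔔` of `E` of prime norm `p` lying over a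
given prime `𝔭` of `K` (necessarily of norm `p`) and satisfying `P` are in bijection with the primes of
`𝓞 E` over `𝔭` of residue degree one satisfying `P`. [folklore] -/
theorem natCard_absNorm_eq_and_under_eq [NumberField E] {p : ℕ} (hp : p.Prime) (q : HeightOneSpectrum (𝓞 K))
    (hq : absNorm q.asIdeal = p) (P : Ideal (𝓞 E) → Prop) :
    Nat.card {𝔔 : HeightOneSpectrum (𝓞 E) // absNorm 𝔔.asIdeal = p ∧ 𝔔.under (𝓞 K) = q ∧ P 𝔔.asIdeal} =
      Nat.card {P' : q.asIdeal.primesOver (𝓞 E) // P'.1.inertiaDeg (𝓞 K) = 1 ∧ P P'.1} := by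
  refine Nat.card_congr
    { toFun := fun 𝔔 ↦ ⟨⟨𝔔.1.asIdeal, 𝔔.1.isPrime, ?_⟩, ?_⟩
      invFun := fun P' ↦ ⟨⟨P'.1.1, P'.1.2.1, ?_⟩, ?_⟩
      left_inv := fun _ ↦ rfl
      right_inv := fun _ ↦ rfl }
  · -- lies over `q`
    exact ⟨congrArg HeightOneSpectrum.asIdeal 𝔔.2.2.1.symm⟩
  · exact ⟨(absNorm_under_eq_and_inertiaDeg_eq_one E 𝔔.1 hp 𝔔.2.1).2, 𝔔.2.2.2⟩
  · exact ne_bot_of_mem_primesOver q.ne_bot P'.1.2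
  · haveI := P'.1.2.2
    have hunder : (⟨P'.1.1, P'.1.2.1, ne_bot_of_mem_primesOver q.ne_bot P'.1.2⟩ :
        HeightOneSpectrum (𝓞 E)).under (𝓞 K) = q := by
      apply HeightOneSpectrum.ext
      rw [HeightOneSpectrum.under_asIdeal]
      exact (P'.1.2.2.over).symm
    refine ⟨absNorm_eq_of_under_eq_of_inertiaDeg_eq_one E _ (by rw [hunder]; exact hq) P'.2.1, hunder, P'.2.2⟩

omit [NumberField L] [IsGalois K L] in
/-- The prime-norm count of a set of primes of `E` at `p`, fibred over the primes of `K` of norm `p`: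
`#{𝔔 ∈ S : N𝔔 = p} = Σ_{N𝔭 = p} #{𝔔 ∈ S : N𝔔 = p, 𝔔 ∩ K = 𝔭}`. [folklore] -/
theorem primeNormCount_eq_sum_under [NumberField E] (S : Set (HeightOneSpectrum (𝓞 E))) {p : ℕ} (hp : p.Prime) :
    primeNormCount E S p = ∑ q ∈ primesOfNorm K p,
      Nat.card {𝔔 : HeightOneSpectrum (𝓞 E) // absNorm 𝔔.asIdeal = p ∧ 𝔔.under (𝓞 K) = q ∧ 𝔔 ∈ S} := by
  rw [primeNormCount]
  rw [Finset.card_eq_sum_card_fiberwise (f := fun 𝔔 : HeightOneSpectrum (𝓞 E) => 𝔔.under (𝓞 K))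
    (t := primesOfNorm K p) ?_]
  · refine Finset.sum_congr rfl fun q _ => ?_
    rw [← Nat.card_eq_finsetCard]
    refine Nat.card_congr (Equiv.subtypeEquivRight fun 𝔔 => ?_)
    simp only [Finset.mem_filter, mem_primesOfNorm]
    tauto
  · intro 𝔔 h𝔔
    rw [Finset.mem_coe, Finset.mem_filter, mem_primesOfNorm] at h𝔔
    rw [Finset.mem_coe, mem_primesOfNorm]
    exact (absNorm_under_eq_and_inertiaDeg_eq_one E 𝔔 hp h𝔔.1).1

variable {E}

/-- **Deuring's count, summed over the primes of `K` of norm `p`.**  Let `L/K` be Galois with group `G`,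
`E` an intermediate field with `H = Gal(L/E)` abelian, `h' ∈ Gal(L/E)` with restriction `h ∈ G`, and `p`
a rational prime such that every prime of `K` of norm `p` is unramified in `L` and every prime of `E` of
norm `p` is unramified in `L`.  Then
`#H · #{𝔔 ⊆ 𝓞_E : N𝔔 = p, 𝔔 unramified, all E-Frobenii above 𝔔 equal h'}
  = #C_G(h) · #{𝔭 ∈ P_{L|K}(h) : N𝔭 = p}`:
fibre over `𝔭 = 𝔔 ∩ K` (`primeNormCount_eq_sum_under`), convert the Frobenius condition to `K`-Frobenii at
degree-one primes (`forall_isArithFrobAt_eq_iff_of_inertiaDeg_eq_one`), and apply the relative Deuring count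
`DegreeOnePrimesRel.card_mul_card_frob_eq_card_conj_eq` (`= #C_G(h)` or `0` according as `Frob_𝔭 ∼ h`).
Neukirch VII (13.4), proof: "`ρ⁻¹(𝔭) ≅ Z(σ)/(σ)`". [cite: NeukirchANT1999, VII (13.4) proof, p. 545] -/
theorem card_mul_primeNormCount_frobenius_eq [NumberField E] [IsMulCommutative E.fixingSubgroup]
    {h : L ≃ₐ[K] L} {h' : L ≃ₐ[E] L} (hh' : h'.restrictScalars K = h) {p : ℕ} (hp : p.Prime)
    (hunrK : ∀ q : HeightOneSpectrum (𝓞 K), absNorm q.asIdeal = p → Algebra.IsUnramifiedIn (𝓞 L) q.asIdeal)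
    (hunrE : ∀ 𝔔 : HeightOneSpectrum (𝓞 E), absNorm 𝔔.asIdeal = p → Algebra.IsUnramifiedIn (𝓞 L) 𝔔.asIdeal) :
    (Nat.card E.fixingSubgroup : ℝ) * primeNormCount E
        {𝔔 : HeightOneSpectrum (𝓞 E) | Algebra.IsUnramifiedIn (𝓞 L) 𝔔.asIdeal ∧
          ∀ 𝔑 ∈ 𝔔.asIdeal.primesOver (𝓞 L), ∀ φ' : L ≃ₐ[E] L, IsArithFrobAt (𝓞 E) φ' 𝔑 → φ' = h'} p =
      (Nat.card (Subgroup.centralizer ({h} : Set (L ≃ₐ[K] L))) : ℝ) *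
        primeNormCount K (primesOfFrobClass K L h) p := by
  have hh : h ∈ E.fixingSubgroup := mem_fixingSubgroup_of_restrictScalars_eq E hh'
  set S : Set (HeightOneSpectrum (𝓞 E)) := {𝔔 | Algebra.IsUnramifiedIn (𝓞 L) 𝔔.asIdeal ∧
    ∀ 𝔑 ∈ 𝔔.asIdeal.primesOver (𝓞 L), ∀ φ' : L ≃ₐ[E] L, IsArithFrobAt (𝓞 E) φ' 𝔑 → φ' = h'} with hS
  -- fibre over the primes of `K` of norm `p`
  rw [primeNormCount_eq_sum_under E S hp, Nat.cast_sum, Finset.mul_sum]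
  -- the right side as a sum of indicators over the same primes
  rw [primeNormCount, Finset.natCast_card_filter, Finset.mul_sum]
  refine Finset.sum_congr rfl fun q hq => ?_
  rw [mem_primesOfNorm] at hq
  have hunr : Algebra.IsUnramifiedIn (𝓞 L) q.asIdeal := hunrK q hq
  obtain ⟨Q₀, hQ₀, F₀, hF₀⟩ := exists_isArithFrobAt_of_heightOneSpectrum (K := K) (L := L) q
  -- the fibre count via the relative Deuring count
  have hfib : Nat.card E.fixingSubgroup *
      Nat.card {𝔔 : HeightOneSpectrum (𝓞 E) // absNorm 𝔔.asIdeal = p ∧ 𝔔.under (𝓞 K) = q ∧ 𝔔 ∈ S} =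
      Nat.card {x : L ≃ₐ[K] L // x * F₀ * x⁻¹ = h} := by
    have h1 : Nat.card {𝔔 : HeightOneSpectrum (𝓞 E) // absNorm 𝔔.asIdeal = p ∧ 𝔔.under (𝓞 K) = q ∧ 𝔔 ∈ S} =
        Nat.card {𝔔 : HeightOneSpectrum (𝓞 E) // absNorm 𝔔.asIdeal = p ∧ 𝔔.under (𝓞 K) = q ∧
          ∀ 𝔑 : Ideal (𝓞 L), 𝔑.IsPrime → 𝔑.LiesOver 𝔔.asIdeal →
            ∀ σ : L ≃ₐ[K] L, IsArithFrobAt (𝓞 K) σ 𝔑 → σ = h} := by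
      refine Nat.card_congr (Equiv.subtypeEquivRight fun 𝔔 ↦ ?_)
      refine and_congr_right fun hN ↦ and_congr_right fun hu ↦ ?_
      have hdeg := absNorm_under_eq_and_inertiaDeg_eq_one E 𝔔 hp hN
      have h𝔔q : ∀ 𝔑 : Ideal (𝓞 L), 𝔑.IsPrime → 𝔑.LiesOver 𝔔.asIdeal → 𝔑 ∈ q.asIdeal.primesOver (𝓞 L) := by
        intro 𝔑 h𝔑p h𝔑o
        refine ⟨h𝔑p, ⟨?_⟩⟩
        rw [← Ideal.under_under (B := 𝓞 E) 𝔑, ← h𝔑o.over]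
        exact congrArg HeightOneSpectrum.asIdeal hu.symm
      have hf : ∀ 𝔑 : Ideal (𝓞 L), 𝔑.LiesOver 𝔔.asIdeal → (𝔑.under (𝓞 E)).inertiaDeg (𝓞 K) = 1 := by
        intro 𝔑 h𝔑o; rw [← h𝔑o.over]; exact hdeg.2
      simp only [hS, Set.mem_setOf_eq]
      constructor
      · rintro ⟨-, hc⟩ 𝔑 h𝔑p h𝔑o σ hσ
        haveI := h𝔑p; haveI := h𝔑o
        exact (forall_isArithFrobAt_eq_iff_of_inertiaDeg_eq_one E hunr (h𝔔q 𝔑 h𝔑p h𝔑o) (hf 𝔑 h𝔑o) hh').mp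
          (hc 𝔑 ⟨h𝔑p, h𝔑o⟩) σ hσ
      · intro hc
        refine ⟨hunrE 𝔔 hN, fun 𝔑 h𝔑 φ' hφ' => ?_⟩
        haveI := h𝔑.1; haveI := h𝔑.2
        exact (forall_isArithFrobAt_eq_iff_of_inertiaDeg_eq_one E hunr (h𝔔q 𝔑 h𝔑.1 h𝔑.2) (hf 𝔑 h𝔑.2) hh').mpr
          (hc 𝔑 h𝔑.1 h𝔑.2) φ' hφ'
    rw [h1, natCard_absNorm_eq_and_under_eq E hp q hq (fun I ↦
      ∀ 𝔑 : Ideal (𝓞 L), 𝔑.IsPrime → 𝔑.LiesOver I → ∀ σ : L ≃ₐ[K] L, IsArithFrobAt (𝓞 K) σ 𝔑 → σ = h)]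
    exact GaloisRepresentations.DegreeOnePrimesRel.card_mul_card_frob_eq_card_conj_eq E hunr hQ₀ hF₀ hh
  -- the indicator of `q ∈ P(h)`
  have hind : (q ∈ primesOfFrobClass K L h) ↔ IsConj F₀ h := by
    constructor
    · intro hmem
      exact (isConj_of_mem_primesOfFrobClass hmem hQ₀ hF₀).symm
    · intro hc
      obtain ⟨x, rfl⟩ := isConj_iff.mp hc
      exact ⟨hunr, x • Q₀, GaloisRepresentations.DegreeOnePrimesRel.smul_mem_primesOver hQ₀ x, hF₀.conj x⟩
  have hfib' : (Nat.card E.fixingSubgroup : ℝ) *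
      (Nat.card {𝔔 : HeightOneSpectrum (𝓞 E) // absNorm 𝔔.asIdeal = p ∧ 𝔔.under (𝓞 K) = q ∧ 𝔔 ∈ S} : ℝ) =
      (Nat.card {x : L ≃ₐ[K] L // x * F₀ * x⁻¹ = h} : ℝ) := by exact_mod_cast hfib
  rw [hfib']
  by_cases hc : IsConj F₀ h
  · rw [GaloisRepresentations.DegreeOnePrimes.card_conj_eq_of_isConj hc, if_pos (hind.mpr hc), mul_one]
  · rw [GaloisRepresentations.DegreeOnePrimes.card_conj_eq_zero_of_not_isConj hc,
      if_neg (fun hm => hc (hind.mp hm)), mul_zero, Nat.cast_zero]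

/-- **Deuring's count holds at all but finitely many rational primes**: with `a = #C_G(h)/#H`,
`#{𝔔 ∈ S_{h'} : N𝔔 = p} = a · #{𝔭 ∈ P_{L|K}(h) : N𝔭 = p}` for every prime `p` which is the norm of no
ramified prime of `K` or of `E` (finitely many exceptions, `finite_setOf_not_isUnramifiedIn`).
[cite: NeukirchANT1999, VII (13.4) proof, p. 545] -/
theorem eventually_primeNormCount_frobenius_eq_mul [NumberField E] [IsMulCommutative E.fixingSubgroup]
    {h : L ≃ₐ[K] L} {h' : L ≃ₐ[E] L} (hh' : h'.restrictScalars K = h) :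
    ∀ᶠ p : Nat.Primes in cofinite,
      (primeNormCount E
        {𝔔 : HeightOneSpectrum (𝓞 E) | Algebra.IsUnramifiedIn (𝓞 L) 𝔔.asIdeal ∧
          ∀ 𝔑 ∈ 𝔔.asIdeal.primesOver (𝓞 L), ∀ φ' : L ≃ₐ[E] L, IsArithFrobAt (𝓞 E) φ' 𝔑 → φ' = h'} p : ℝ) =
      ((Nat.card (Subgroup.centralizer ({h} : Set (L ≃ₐ[K] L))) : ℝ) / Nat.card E.fixingSubgroup) *
        primeNormCount K (primesOfFrobClass K L h) p := by
  -- the finitely many bad primes: norms of ramified primes of `K` and of `E`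
  have hfinK := GaloisRepresentations.finite_setOf_not_isUnramifiedIn K L
  have hfinE := GaloisRepresentations.finite_setOf_not_isUnramifiedIn E L
  have hbad : {p : Nat.Primes | (∃ q : HeightOneSpectrum (𝓞 K), ¬ Algebra.IsUnramifiedIn (𝓞 L) q.asIdeal ∧
      absNorm q.asIdeal = p) ∨ (∃ 𝔔 : HeightOneSpectrum (𝓞 E), ¬ Algebra.IsUnramifiedIn (𝓞 L) 𝔔.asIdeal ∧
      absNorm 𝔔.asIdeal = p)}.Finite := by
    refine Set.Finite.union (s := {p : Nat.Primes | ∃ q : HeightOneSpectrum (𝓞 K),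
      ¬ Algebra.IsUnramifiedIn (𝓞 L) q.asIdeal ∧ absNorm q.asIdeal = p}) (t := {p : Nat.Primes |
      ∃ 𝔔 : HeightOneSpectrum (𝓞 E), ¬ Algebra.IsUnramifiedIn (𝓞 L) 𝔔.asIdeal ∧ absNorm 𝔔.asIdeal = p}) ?_ ?_
    · refine (hfinK.image (fun q => absNorm q.asIdeal)).preimage
        (Set.injOn_of_injective Nat.Primes.coe_nat_injective) |>.subset ?_
      rintro p ⟨q, hq, hqp⟩
      exact ⟨q, hq, hqp⟩
    · refine (hfinE.image (fun 𝔔 => absNorm 𝔔.asIdeal)).preimage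
        (Set.injOn_of_injective Nat.Primes.coe_nat_injective) |>.subset ?_
      rintro p ⟨𝔔, h𝔔, h𝔔p⟩
      exact ⟨𝔔, h𝔔, h𝔔p⟩
  refine Filter.eventually_of_mem hbad.compl_mem_cofinite fun p hp => ?_
  simp only [Set.mem_compl_iff, Set.mem_setOf_eq, not_or, not_exists, not_and] at hp
  have hunrK : ∀ q : HeightOneSpectrum (𝓞 K), absNorm q.asIdeal = p → Algebra.IsUnramifiedIn (𝓞 L) q.asIdeal :=
    fun q hq => not_not.mp fun hn => hp.1 q hn hq
  have hunrE : ∀ 𝔔 : HeightOneSpectrum (𝓞 E), absNorm 𝔔.asIdeal = p → Algebra.IsUnramifiedIn (𝓞 L) 𝔔.asIdeal :=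
    fun 𝔔 h𝔔 => not_not.mp fun hn => hp.2 𝔔 hn h𝔔
  have key := card_mul_primeNormCount_frobenius_eq hh' p.2 hunrK hunrE
  have hHpos : (0 : ℝ) < Nat.card E.fixingSubgroup := by exact_mod_cast Nat.card_pos
  rw [div_mul_eq_mul_div, eq_div_iff hHpos.ne', mul_comm]
  exact key

end Deuring

/-! ### The density of `P_{L|K}(h)` -/

section PerClass

variable {K L : Type} [Field K] [NumberField K] [Field L] [NumberField L] [Algebra K L] [IsGalois K L]

/-- **Natural density of `P_{L|K}(h)`** (Neukirch VII (13.4) in natural-density form, one class): for every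
`h ∈ G = Gal(L/K)`, `#{𝔭 ∈ P_{L|K}(h) : N𝔭 ≤ N} · log N / N → #⟨h⟩/#G` (the count written as
`Σ_{n ≤ N} #{𝔭 ∈ P_{L|K}(h) : N𝔭 = n}`).  Deuring's reduction: with `E = L^{⟨h⟩}` (so `L/E` is cyclic,
generated by `h`), the cyclic case over `E` (`tendsto_sum_primeNormCount_frobenius_eq_mul_log_div`) is
pushed down along `𝔔 ↦ 𝔔 ∩ K` (`eventually_primeNormCount_frobenius_eq_mul`,
`tendsto_of_primeNormCount_eq_mul`), and `#⟨h⟩ · #C_G(h) = #G`.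
[cite: NeukirchANT1999, VII Thm. (13.4) and proof, p. 545] -/
theorem tendsto_sum_primeNormCount_primesOfFrobClass_mul_log_div (h : L ≃ₐ[K] L) :
    Tendsto (fun N : ℕ => (∑ n ∈ Icc 1 N, (primeNormCount K (primesOfFrobClass K L h) n : ℝ)) *
        Real.log N / N)
      atTop (𝓝 ((Nat.card {τ : L ≃ₐ[K] L | IsConj h τ} : ℝ) / Nat.card (L ≃ₐ[K] L))) := by
  -- the fixed field of `⟨h⟩`
  set H : Subgroup (L ≃ₐ[K] L) := Subgroup.zpowers h with hHdef
  set E : IntermediateField K L := IntermediateField.fixedField H with hEdef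
  have hEH : E.fixingSubgroup = H := IntermediateField.fixingSubgroup_fixedField H
  haveI : NumberField E := NumberField.of_module_finite K E
  haveI : IsGalois E L := IsGalois.tower_top_of_isGalois K E L
  haveI : IsCyclic E.fixingSubgroup := by rw [hEH, hHdef]; infer_instance
  haveI : IsMulCommutative E.fixingSubgroup := IsCyclic.isMulCommutative
  set eE : E.fixingSubgroup ≃* (L ≃ₐ[E] L) := IntermediateField.fixingSubgroupEquiv E with heE
  haveI : IsCyclic (L ≃ₐ[E] L) := isCyclic_of_surjective eE.toMonoidHom eE.surjective
  have hh : h ∈ E.fixingSubgroup := by rw [hEH, hHdef]; exact Subgroup.mem_zpowers h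
  set h' : L ≃ₐ[E] L := eE ⟨h, hh⟩ with hh'def
  have hres : ∀ φ' : L ≃ₐ[E] L, ((eE.symm φ' : E.fixingSubgroup) : L ≃ₐ[K] L) = φ'.restrictScalars K :=
    fun _ ↦ rfl
  have hh' : h'.restrictScalars K = h := by
    rw [← hres, hh'def, MulEquiv.symm_apply_apply]
  -- the cyclic case over `E`
  have hC := tendsto_sum_primeNormCount_frobenius_eq_mul_log_div (E := E) (L := L) h'
  -- push down
  have hrel := eventually_primeNormCount_frobenius_eq_mul (E := E) hh'
  have hHcard : (Nat.card E.fixingSubgroup : ℝ) = Module.finrank E L := by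
    rw [Nat.card_congr eE.toEquiv, IsGalois.card_aut_eq_finrank]
  have hHpos : (0 : ℝ) < Nat.card E.fixingSubgroup := by exact_mod_cast Nat.card_pos
  have hCpos : (0 : ℝ) < Nat.card (Subgroup.centralizer ({h} : Set (L ≃ₐ[K] L))) := by
    exact_mod_cast Nat.card_pos
  have ha : (0 : ℝ) < (Nat.card (Subgroup.centralizer ({h} : Set (L ≃ₐ[K] L))) : ℝ) /
      Nat.card E.fixingSubgroup := div_pos hCpos hHpos
  have hT := tendsto_of_primeNormCount_eq_mul _ _ ha hrel hC
  have hclass := card_setOf_isConj_mul_card_centralizer h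
  have hGpos : (0 : ℝ) < Nat.card (L ≃ₐ[K] L) := by exact_mod_cast Nat.card_pos
  have hclpos : (Nat.card {τ : L ≃ₐ[K] L | IsConj h τ} : ℝ) ≠ 0 := by
    have : Nonempty {τ : L ≃ₐ[K] L | IsConj h τ} := ⟨⟨h, IsConj.refl h⟩⟩
    exact_mod_cast Nat.card_pos.ne'
  have hid : 1 / (Module.finrank E L : ℝ) /
      ((Nat.card (Subgroup.centralizer ({h} : Set (L ≃ₐ[K] L))) : ℝ) / Nat.card E.fixingSubgroup) =
      (Nat.card {τ : L ≃ₐ[K] L | IsConj h τ} : ℝ) / Nat.card (L ≃ₐ[K] L) := by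
    rw [← hclass, ← hHcard]
    push_cast
    field_simp
  rw [hid] at hT
  exact hT

/-- **Natural density of `primesOfFrobIn K L C` for conjugation-stable `C`**:
`#{𝔭 ∈ P(C) : N𝔭 ≤ N} · log N / N → #C/#G` — the densities of the classes `⟨σ⟩ ⊆ C` add up
(`indicator_primesOfFrobIn_eq_sum`: `1_{P(C)} = Σ_{σ ∈ C} (#⟨σ⟩)⁻¹ 1_{P(σ)}`).  Serre 1981, §2.1, eq. (9):
`π_C(x) = (|C|/|G|) x/log x + o(x/log x)`. [cite: Serre1981, §2.1 Thm. 1 with (9) (p. 331)] -/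
theorem tendsto_sum_primeNormCount_primesOfFrobIn_mul_log_div {C : Set (L ≃ₐ[K] L)}
    (hC : ∀ g ∈ C, ∀ τ : L ≃ₐ[K] L, τ * g * τ⁻¹ ∈ C) :
    Tendsto (fun N : ℕ => (∑ n ∈ Icc 1 N, (primeNormCount K (primesOfFrobIn K L C) n : ℝ)) *
        Real.log N / N)
      atTop (𝓝 ((Nat.card C : ℝ) / Nat.card (L ≃ₐ[K] L))) := by
  have hC' : ∀ g h : L ≃ₐ[K] L, h ∈ C → g * h * g⁻¹ ∈ C := fun g h hh => hC h hh g
  -- the count of `P(C)` as a combination of the counts of the `P(σ)`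
  have hcount : ∀ n : ℕ, (primeNormCount K (primesOfFrobIn K L C) n : ℝ) =
      ∑ σ ∈ C.toFinset, ((Nat.card {τ : L ≃ₐ[K] L | IsConj σ τ} : ℝ))⁻¹ *
        (primeNormCount K (primesOfFrobClass K L σ) n : ℝ) := by
    intro n
    rw [primeNormCount_eq_sum_indicator]
    simp_rw [indicator_primesOfFrobIn_eq_sum hC', primeNormCount_eq_sum_indicator, Finset.mul_sum]
    rw [Finset.sum_comm]
  have hlim : ∀ σ : L ≃ₐ[K] L, Tendsto (fun N : ℕ => ((Nat.card {τ : L ≃ₐ[K] L | IsConj σ τ} : ℝ))⁻¹ *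
      ((∑ n ∈ Icc 1 N, (primeNormCount K (primesOfFrobClass K L σ) n : ℝ)) * Real.log N / N)) atTop
      (𝓝 (((Nat.card {τ : L ≃ₐ[K] L | IsConj σ τ} : ℝ))⁻¹ *
        ((Nat.card {τ : L ≃ₐ[K] L | IsConj σ τ} : ℝ) / Nat.card (L ≃ₐ[K] L)))) :=
    fun σ => (tendsto_sum_primeNormCount_primesOfFrobClass_mul_log_div σ).const_mul _
  have hsum := tendsto_finsetSum C.toFinset fun σ _ => hlim σ
  have hval : ∑ σ ∈ C.toFinset, ((Nat.card {τ : L ≃ₐ[K] L | IsConj σ τ} : ℝ))⁻¹ *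
      ((Nat.card {τ : L ≃ₐ[K] L | IsConj σ τ} : ℝ) / Nat.card (L ≃ₐ[K] L)) =
      (Nat.card C : ℝ) / Nat.card (L ≃ₐ[K] L) := by
    have hne : ∀ σ : L ≃ₐ[K] L, (Nat.card {τ : L ≃ₐ[K] L | IsConj σ τ} : ℝ) ≠ 0 := fun σ => by
      have : Nonempty {τ : L ≃ₐ[K] L | IsConj σ τ} := ⟨⟨σ, IsConj.refl σ⟩⟩
      exact_mod_cast Nat.card_pos.ne'
    have hterm : ∀ σ ∈ C.toFinset, ((Nat.card {τ : L ≃ₐ[K] L | IsConj σ τ} : ℝ))⁻¹ *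
        ((Nat.card {τ : L ≃ₐ[K] L | IsConj σ τ} : ℝ) / Nat.card (L ≃ₐ[K] L)) = 1 / Nat.card (L ≃ₐ[K] L) := by
      intro σ _
      rw [← mul_div_assoc, inv_mul_cancel₀ (hne σ)]
    rw [Finset.sum_congr rfl hterm, Finset.sum_const, nsmul_eq_mul, Nat.card_coe_set_eq,
      Set.ncard_eq_toFinset_card']
    ring
  rw [hval] at hsum
  refine hsum.congr fun N => ?_
  symm
  rw [Finset.sum_congr rfl (fun n _ => hcount n), Finset.sum_comm]
  simp_rw [← Finset.mul_sum]
  rw [Finset.sum_mul, Finset.sum_div]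
  refine Finset.sum_congr rfl fun σ _ => ?_
  ring

end PerClass

/-! ### From counts along `ℕ` to the ratio `π_C(x)/π_K(x)` -/

section Ratio

variable {K : Type} [Field K] [NumberField K]

/-- The set of primes of `X` of norm `≤ x` is finite. [folklore] -/
theorem finite_sep_absNorm_le (X : Set (HeightOneSpectrum (𝓞 K))) (x : ℝ) :
    {v ∈ X | (absNorm v.asIdeal : ℝ) ≤ x}.Finite := by
  refine ((Ideal.finite_setOf_absNorm_le (S := 𝓞 K) ⌊x⌋₊).preimage
    (Set.injOn_of_injective (f := fun v : HeightOneSpectrum (𝓞 K) => v.asIdeal)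
      (fun v w h => HeightOneSpectrum.ext h))).subset ?_
  rintro v ⟨-, hv⟩
  exact Nat.le_floor hv

/-- **The norm count as a sum over norms**: `#{𝔭 ∈ X : N𝔭 ≤ N} = Σ_{1 ≤ n ≤ N} #{𝔭 ∈ X : N𝔭 = n}`.
[folklore] -/
theorem ncard_sep_absNorm_le_eq_sum (X : Set (HeightOneSpectrum (𝓞 K))) (N : ℕ) :
    ({v ∈ X | (absNorm v.asIdeal : ℝ) ≤ N}.ncard : ℝ) = ∑ n ∈ Icc 1 N, (primeNormCount K X n : ℝ) := by
  have hfin := finite_sep_absNorm_le X N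
  rw [Set.ncard_eq_toFinset_card _ hfin]
  have hnat : hfin.toFinset.card = ∑ n ∈ Icc 1 N, primeNormCount K X n := by
    rw [Finset.card_eq_sum_card_fiberwise (f := fun v : HeightOneSpectrum (𝓞 K) => absNorm v.asIdeal)
      (t := Icc 1 N) ?_]
    · refine Finset.sum_congr rfl fun n hn => ?_
      rw [primeNormCount]
      refine congrArg Finset.card ?_
      ext v
      simp only [Finset.mem_filter, Set.Finite.mem_toFinset, Set.mem_setOf_eq, mem_primesOfNorm]
      constructor
      · rintro ⟨⟨hvX, -⟩, hv⟩; exact ⟨hv, hvX⟩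
      · rintro ⟨hv, hvX⟩
        refine ⟨⟨hvX, ?_⟩, hv⟩
        rw [hv]
        exact_mod_cast (Finset.mem_Icc.mp hn).2
    · intro v hv
      rw [Finset.mem_coe, Set.Finite.mem_toFinset] at hv
      rw [Finset.mem_coe, Finset.mem_Icc]
      refine ⟨(AbelianDensity.two_le_absNorm K v).trans' (by norm_num), ?_⟩
      exact_mod_cast hv.2
  rw [hnat]
  push_cast
  rfl

/-- The counting set depends on `⌊x⌋` only (`N𝔭 ≤ x ↔ N𝔭 ≤ ⌊x⌋` for `x ≥ 0`). [folklore] -/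
theorem sep_absNorm_le_eq_floor (X : Set (HeightOneSpectrum (𝓞 K))) {x : ℝ} (hx : 0 ≤ x) :
    {v ∈ X | (absNorm v.asIdeal : ℝ) ≤ x} = {v ∈ X | (absNorm v.asIdeal : ℝ) ≤ (⌊x⌋₊ : ℕ)} := by
  ext v
  simp only [Set.mem_setOf_eq]
  refine and_congr_right fun _ => ?_
  rw [Nat.cast_le]
  exact ⟨fun h => Nat.le_floor h, fun h => (Nat.floor_le hx).trans' (by exact_mod_cast h)⟩

/-- `π_K` depends on `⌊x⌋` only. [folklore] -/
theorem primeIdealCount_eq_floor (x : ℝ) (hx : 0 ≤ x) :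
    NumberField.primeIdealCount K x = NumberField.primeIdealCount K (⌊x⌋₊ : ℕ) := by
  rw [NumberField.primeIdealCount_eq_sum_normPrimeIdealCount K hx,
    NumberField.primeIdealCount_eq_sum_normPrimeIdealCount K (Nat.cast_nonneg _), Nat.floor_natCast]

/-- **`π_K(N) · log N / N → 1`** along the integers (Landau's prime ideal theorem,
`NumberField.isEquivalent_primeIdealCount`). [cite: LandauMathAnn1903, Primidealsatz] -/
theorem tendsto_primeIdealCount_mul_log_div (K : Type) [Field K] [NumberField K] :
    Tendsto (fun N : ℕ => (NumberField.primeIdealCount K N : ℝ) * Real.log N / N) atTop (𝓝 1) := by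
  have h := NumberField.isEquivalent_primeIdealCount K
  have hne : ∀ᶠ x : ℝ in atTop, x / Real.log x ≠ 0 := by
    filter_upwards [eventually_gt_atTop 1] with x hx
    exact div_ne_zero (by linarith) (Real.log_pos hx).ne'
  have h1 := (isEquivalent_iff_tendsto_one hne).mp h
  have h2 := h1.comp tendsto_natCast_atTop_atTop
  refine h2.congr' ?_
  filter_upwards [eventually_gt_atTop 1] with N hN1
  simp only [Pi.div_apply, Function.comp_apply]
  have hN : (0 : ℝ) < N := by exact_mod_cast (by omega : 0 < N)
  have hlog : Real.log N ≠ 0 := (Real.log_pos (by exact_mod_cast hN1)).ne'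
  field_simp

/-- **From counts to the ratio.**  If `#{𝔭 ∈ X : N𝔭 ≤ N} log N/N → c` (as a sum over norms) then
`#{𝔭 ∈ X : N𝔭 ≤ x}/π_K(x) → c` as the real variable `x → ∞`. [folklore] -/
theorem tendsto_ncard_div_primeIdealCount (X : Set (HeightOneSpectrum (𝓞 K))) {c : ℝ}
    (hX : Tendsto (fun N : ℕ => (∑ n ∈ Icc 1 N, (primeNormCount K X n : ℝ)) * Real.log N / N) atTop (𝓝 c)) :
    Tendsto (fun x : ℝ => ({v ∈ X | (absNorm v.asIdeal : ℝ) ≤ x}.ncard : ℝ) /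
      (NumberField.primeIdealCount K x : ℝ)) atTop (𝓝 c) := by
  -- along the integers
  have hπ := tendsto_primeIdealCount_mul_log_div K
  have hnat : Tendsto (fun N : ℕ => ({v ∈ X | (absNorm v.asIdeal : ℝ) ≤ N}.ncard : ℝ) /
      (NumberField.primeIdealCount K N : ℝ)) atTop (𝓝 c) := by
    have h := hX.div hπ one_ne_zero
    rw [div_one] at h
    refine h.congr' ?_
    filter_upwards [eventually_gt_atTop 1, hπ.eventually (eventually_ne_nhds one_ne_zero)] with N hN1 hπN
    have hN : (0 : ℝ) < N := by exact_mod_cast (by omega : 0 < N)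
    have hlog : Real.log N ≠ 0 := (Real.log_pos (by exact_mod_cast hN1)).ne'
    have hπ0 : (NumberField.primeIdealCount K N : ℝ) ≠ 0 := by
      intro h0; rw [h0, zero_mul, zero_div] at hπN; exact hπN rfl
    rw [ncard_sep_absNorm_le_eq_sum X N]
    simp only [Pi.div_apply]
    field_simp
  -- through `⌊x⌋`
  refine (hnat.comp tendsto_nat_floor_atTop).congr' ?_
  filter_upwards [eventually_ge_atTop (0 : ℝ)] with x hx
  simp only [Function.comp_apply]
  rw [sep_absNorm_le_eq_floor X hx, primeIdealCount_eq_floor x hx]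

end Ratio

/-! ### The theorem -/

/-- **Chebotarev's density theorem in natural-density form (Serre 1981, §2.1, Théorème 1) — PROVED.**
For every finite Galois extension `L|K` of number fields with group `G` and every conjugation-stable
`C ⊆ G`: `π_C(x)/π_K(x) → |C|/|G|` (`HasNaturalChebotarevDensities K L`), where `π_C(x)` counts the primes
of `K` unramified in `L` with Frobenius class in `C` and norm `≤ x`.  Discharge of the named fact
`chebotarev_naturalDensity`: Deuring's reduction to the cyclic case (Neukirch VII (13.4)), the cyclic case by
Artin reciprocity, Hecke–Landau `L(1+it, χ) ≠ 0` and the Wiener–Ikehara theorem, and Landau's prime ideal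
theorem for the denominator — all theorems of the tree. [cite: Serre1981, §2.1 Thm. 1 (p. 331)] -/
theorem chebotarev_naturalDensity_holds : chebotarev_naturalDensity := by
  intro K L _ _ _ _ _ _ C hC
  exact tendsto_ncard_div_primeIdealCount (primesOfFrobIn K L C)
    (tendsto_sum_primeNormCount_primesOfFrobIn_mul_log_div hC)

end Literature.NumberTheory.LFunctions.Chebotarev

end
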